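import Summits.CriticalPhenomena.PercolationContinuityZ3.Theorems.PercNearOneGluingNoHeavyLowerTailSunflowerParityLemma
import HarnessLib
import HarnessLib.Audit

/-!
# `NoHeavyLowerTail` (crux stmt-CriticalPhenomena-4575), abstract sunflower cubic: HALL–GLADKOV — the GF(2) KERNEL LEMMA

Support file (seat `prim-l12-p2` gen 17; `--supports stmt-CriticalPhenomena-4575`).  No `sorry`, no new definitions.
Memo: run/shared/lean/prim/prim-l12/prim-l12-p2/FINDING-g17-HALL-GLADKOV-PROVED.md.

For up-sets `V₁, V₂` and a cube `W` (families `POS = HallGladkov.pos V₁ V₂ W`, `NEG = HallGladkov.neg V₁ V₂ W` of `…SunflowerHallGladkov`;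
`V = V₁ ∪ V₂`, `IN(V) = {S ⊆ W : S ∈ V, W∖S ∉ V}`, so that `NEG = {W∖S : S ∈ IN(V)}` is a down-set of the cube) we prove the
**KERNEL LEMMA** (`pos_kernel_trivial`): if `λ : POS → GF(2)` has `Σ_{T ∈ POS, T ⊇ O} λ_T = 0` for every `O ∈ NEG`, then `λ = 0`.
Equivalently: the `POS × NEG` containment matrix `[O ⊆ T]` has FULL ROW RANK over `GF(2)`.  (The companion file
`…SunflowerHallGladkovProof` turns this into `IXGen`, `HallGladkov` and ★ for sunflowers with an intersecting petal.)
Proof (all sums in `ZMod 2`):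
* (I1) `test_functional`: for `S ∈ IN(V)`, `Σ_{O ∈ NEG, O ⊆ T} w^S(O) = c(T,S)` with `w^S(O) = #{C ∈ NEG : O ∪ (W∖S) ⊆ C}`,
  `c(T,S) = #{R ∈ IN(V) : T ⊆ R ⊆ S}` — pairing the hypothesis against `w^S` gives `Σ_T λ_T c(T,S) = 0` for all `S ∈ IN(V)`;
* (I2) `cfun_diag`: `c(T,S) = [T = S]` for `T ∈ IN(V)`;  (I3) `cfun_add_gam`: `c(T,S) = γ(T,S) := #{R ∈ [T,S] : W∖R ∈ V₂}` for a cross set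
  `T ∈ X12` (`T ∈ V₁∖V₂`, `W∖T ∈ V₂∖V₁`) and `S ≠ T`;
* on kernel–bottom sets `S` only the cross part survives: `Σ_{T ∈ X12} λ_T γ(T,S) = 0`, which extends to every `S ∈ IN(V₂)` and is
  inverted by the parity lemma `Ξ² = I` (`gam_del_sum` of `…SunflowerParityLemma`): `λ = 0` on `X12`; then (I2) gives `λ = 0` on `POS ∩ IN(V)`.
-/

namespace Summit.CriticalPhenomena.PercolationContinuityZ3.Theorems.SunflowerPartition

open Finset

namespace HallGladkov

variable {α : Type*} [DecidableEq α]

/-! ## Small tools -/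

omit [DecidableEq α] in
/-- Indicators of equivalent propositions agree. [folklore] -/
theorem ite_one_zero_congr {P Q : Prop} [Decidable P] [Decidable Q] (h : P ↔ Q) :
    (if P then (1 : ZMod 2) else 0) = if Q then 1 else 0 := by
  by_cases hP : P
  · rw [if_pos hP, if_pos (h.1 hP)]
  · rw [if_neg hP, if_neg fun hQ => hP (h.2 hQ)]

/-- Membership in `NEG`, unfolded. [this work] -/
theorem mem_neg_iff {V₁ V₂ : Finset (Finset α)} {W O : Finset α} :
    O ∈ neg V₁ V₂ W ↔ O ⊆ W ∧ O ∉ V₁ ∧ O ∉ V₂ ∧ (W \ O ∈ V₁ ∨ W \ O ∈ V₂) := by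
  unfold neg; rw [mem_filter, mem_powerset]

/-- Membership in `POS`, unfolded. [this work] -/
theorem mem_pos_iff {V₁ V₂ : Finset (Finset α)} {W T : Finset α} :
    T ∈ pos V₁ V₂ W ↔ T ⊆ W ∧ ((T ∈ V₁ ∧ T ∉ V₂ ∧ W \ T ∉ V₁) ∨ (T ∈ V₂ ∧ T ∉ V₁ ∧ W \ T ∉ V₁ ∧ W \ T ∉ V₂)) := by
  unfold pos; rw [mem_filter, mem_powerset]

/-- Membership in `IN(G)`, unfolded. [this work] -/
theorem mem_inV_iff {G : Finset (Finset α)} {W S : Finset α} : S ∈ inV G W ↔ S ⊆ W ∧ S ∈ G ∧ W \ S ∉ G := by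
  unfold inV; rw [mem_filter, mem_powerset]

/-- Membership in `OUT(G)`, unfolded. [this work] -/
theorem mem_outV_iff {G : Finset (Finset α)} {W T : Finset α} : T ∈ outV G W ↔ T ⊆ W ∧ T ∉ G ∧ W \ T ∈ G := by
  unfold outV; rw [mem_filter, mem_powerset]

/-- `NEG` is a down-set of the cube. [this work] -/
theorem neg_down {V₁ V₂ : Finset (Finset α)} (h₁ : IsUpperSet (V₁ : Set (Finset α))) (h₂ : IsUpperSet (V₂ : Set (Finset α)))
    {W O O' : Finset α} (hO : O ∈ neg V₁ V₂ W) (hO' : O' ⊆ O) : O' ∈ neg V₁ V₂ W := by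
  rw [mem_neg_iff] at hO ⊢
  obtain ⟨hOW, hO1, hO2, hOc⟩ := hO
  have hc : W \ O ⊆ W \ O' := Finset.sdiff_subset_sdiff subset_rfl hO'
  refine ⟨hO'.trans hOW, up_not_mem h₁ hO' hO1, up_not_mem h₂ hO' hO2, ?_⟩
  rcases hOc with h | h
  · exact Or.inl (up_mem h₁ hc h)
  · exact Or.inr (up_mem h₂ hc h)

/-- The number of `NEG`-sets below a `NEG`-set `X` is `2^{|X|}`: odd iff `X = ∅`. [this work] -/
theorem sum_neg_ite_subset {V₁ V₂ : Finset (Finset α)} (h₁ : IsUpperSet (V₁ : Set (Finset α))) (h₂ : IsUpperSet (V₂ : Set (Finset α)))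
    {W X : Finset α} (hX : X ∈ neg V₁ V₂ W) :
    (∑ O ∈ neg V₁ V₂ W, (if O ⊆ X then (1 : ZMod 2) else 0)) = if X = ∅ then 1 else 0 := by
  have hf : (neg V₁ V₂ W).filter (fun O => O ⊆ X) = X.powerset.filter (fun O => (∅ : Finset α) ⊆ O) := by
    ext O
    simp only [mem_filter, mem_powerset, empty_subset, and_true]
    exact ⟨fun h => h.2, fun h => ⟨neg_down h₁ h₂ hX h, h⟩⟩
  rw [Finset.sum_boole, hf, ← Finset.sum_boole, sum_powerset_ite_superset]
  by_cases h : X = ∅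
  · rw [if_pos h, if_pos h.symm]
  · rw [if_neg h, if_neg (Ne.symm h)]

/-! ## (I1): the test functionals -/

/-- **(I1)** For `S ∈ IN(V)` (`S ⊆ W`, `S ∈ V₁ ∪ V₂`, `W∖S ∉ V₁ ∪ V₂`) and `T ⊆ W`:
`Σ_{O ∈ NEG, O ⊆ T} w^S(O) ≡ c(T,S)`, where `w^S(O) = #{C ∈ NEG : O ∪ (W∖S) ⊆ C}` and
`c(T,S) = #{R ∈ IN(V) : T ⊆ R ⊆ S}`. [this work] -/
theorem test_functional {V₁ V₂ : Finset (Finset α)} (h₁ : IsUpperSet (V₁ : Set (Finset α))) (h₂ : IsUpperSet (V₂ : Set (Finset α)))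
    {W S T : Finset α} (hTW : T ⊆ W) :
    (∑ O ∈ neg V₁ V₂ W, (if O ⊆ T then
        (∑ C ∈ neg V₁ V₂ W, (if O ⊆ C ∧ W \ S ⊆ C then (1 : ZMod 2) else 0)) else 0))
      = ∑ R ∈ W.powerset,
          (if ((R ∈ V₁ ∨ R ∈ V₂) ∧ W \ R ∉ V₁ ∧ W \ R ∉ V₂) ∧ (T ⊆ R ∧ R ⊆ S) then (1 : ZMod 2) else 0) := by
  -- push the outer indicator inside and exchange the sums
  rw [show (∑ O ∈ neg V₁ V₂ W, (if O ⊆ T then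
        (∑ C ∈ neg V₁ V₂ W, (if O ⊆ C ∧ W \ S ⊆ C then (1 : ZMod 2) else 0)) else 0))
      = ∑ C ∈ neg V₁ V₂ W, ∑ O ∈ neg V₁ V₂ W,
          ((if W \ S ⊆ C then (1 : ZMod 2) else 0) * (if O ⊆ T ∩ C then 1 else 0)) by
    rw [Finset.sum_comm]
    refine sum_congr rfl fun O _ => ?_
    by_cases hOT : O ⊆ T
    · rw [if_pos hOT]
      refine sum_congr rfl fun C _ => ?_
      rw [ite_zero_mul_ite_zero, one_mul]
      exact ite_one_zero_congr ⟨fun ⟨hOC, hSC⟩ => ⟨hSC, subset_inter hOT hOC⟩,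
        fun ⟨hSC, hOTC⟩ => ⟨(subset_inter_iff.1 hOTC).2, hSC⟩⟩
    · rw [if_neg hOT]
      refine (sum_eq_zero fun C _ => ?_).symm
      rw [ite_zero_mul_ite_zero, if_neg]
      rintro ⟨-, hOTC⟩
      exact hOT (subset_inter_iff.1 hOTC).1]
  -- the inner sum counts the subsets of `T ∩ C`: odd iff `T ∩ C = ∅`
  rw [show (∑ C ∈ neg V₁ V₂ W, ∑ O ∈ neg V₁ V₂ W,
          ((if W \ S ⊆ C then (1 : ZMod 2) else 0) * (if O ⊆ T ∩ C then 1 else 0)))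
      = ∑ C ∈ neg V₁ V₂ W, ((if W \ S ⊆ C then (1 : ZMod 2) else 0) * (if T ∩ C = ∅ then 1 else 0)) by
    refine sum_congr rfl fun C hC => ?_
    rw [← Finset.mul_sum, sum_neg_ite_subset h₁ h₂ (neg_down h₁ h₂ hC inter_subset_right)]]
  -- pass to the complement `R = W ∖ C`
  unfold neg
  rw [Finset.sum_filter, ← sum_powerset_compl W (fun R =>
      (if ((R ∈ V₁ ∨ R ∈ V₂) ∧ W \ R ∉ V₁ ∧ W \ R ∉ V₂) ∧ (T ⊆ R ∧ R ⊆ S) then (1 : ZMod 2) else 0))]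
  refine sum_congr rfl fun C hC => ?_
  have hCW : C ⊆ W := mem_powerset.1 hC
  have e3 : W \ (W \ C) = C := Finset.sdiff_sdiff_eq_self hCW
  have e1 : T ⊆ W \ C ↔ T ∩ C = ∅ := by
    rw [Finset.subset_sdiff, Finset.disjoint_iff_inter_eq_empty]
    exact ⟨fun h => h.2, fun h => ⟨hTW, h⟩⟩
  have e2 : W \ C ⊆ S ↔ W \ S ⊆ C := by
    constructor
    · intro h x hx
      rw [mem_sdiff] at hx
      by_contra hxC
      exact hx.2 (h (mem_sdiff.2 ⟨hx.1, hxC⟩))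
    · intro h x hx
      rw [mem_sdiff] at hx
      by_contra hxS
      exact hx.2 (h (mem_sdiff.2 ⟨hx.1, hxS⟩))
  simp only [e3]
  by_cases hn : C ∉ V₁ ∧ C ∉ V₂ ∧ (W \ C ∈ V₁ ∨ W \ C ∈ V₂)
  · rw [if_pos hn, ite_zero_mul_ite_zero, one_mul]
    exact ite_one_zero_congr ⟨fun ⟨hSC, hTC⟩ => ⟨⟨hn.2.2, hn.1, hn.2.1⟩, e1.2 hTC, e2.2 hSC⟩,
      fun ⟨_, hTC, hCS⟩ => ⟨e2.1 hCS, e1.1 hTC⟩⟩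
  · rw [if_neg hn, if_neg]
    rintro ⟨⟨hc, h1, h2⟩, -, -⟩
    exact hn ⟨h1, h2, hc⟩

/-! ## (I2), (I3): values of `c(T,S)` -/

/-- **(I2)** For `T ∈ IN(V)` and `S ⊆ W`: `c(T,S) ≡ [T = S]` (the whole interval `[T,S]` lies in the up-set `IN(V)`). [this work] -/
theorem cfun_diag {V₁ V₂ : Finset (Finset α)} (h₁ : IsUpperSet (V₁ : Set (Finset α))) (h₂ : IsUpperSet (V₂ : Set (Finset α)))
    {W S T : Finset α} (hSW : S ⊆ W) (hT : (T ∈ V₁ ∨ T ∈ V₂) ∧ W \ T ∉ V₁ ∧ W \ T ∉ V₂) :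
    (∑ R ∈ W.powerset,
        (if ((R ∈ V₁ ∨ R ∈ V₂) ∧ W \ R ∉ V₁ ∧ W \ R ∉ V₂) ∧ (T ⊆ R ∧ R ⊆ S) then (1 : ZMod 2) else 0))
      = if T = S then 1 else 0 := by
  rw [← sum_powerset_ite_Icc (A := T) hSW]
  refine sum_congr rfl fun R _ => ?_
  refine ite_one_zero_congr ⟨fun h => h.2, fun h => ⟨?_, h⟩⟩
  have hc : W \ R ⊆ W \ T := Finset.sdiff_subset_sdiff subset_rfl h.1
  refine ⟨?_, up_not_mem h₁ hc hT.2.1, up_not_mem h₂ hc hT.2.2⟩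
  rcases hT.1 with hT1 | hT2
  · exact Or.inl (up_mem h₁ h.1 hT1)
  · exact Or.inr (up_mem h₂ h.1 hT2)

/-- **(I3)** For `T ∈ V₁` with `W∖T ∉ V₁` and `S ⊆ W`: `c(T,S) + γ(T,S) ≡ [T = S]`, where `γ(T,S) = #{R ∈ [T,S] : W∖R ∈ V₂}`
(inside `[T,S]`, membership in `IN(V)` is exactly `W∖R ∉ V₂`). [this work] -/
theorem cfun_add_gam {V₁ V₂ : Finset (Finset α)} (h₁ : IsUpperSet (V₁ : Set (Finset α)))
    {W S T : Finset α} (hSW : S ⊆ W) (hT1 : T ∈ V₁) (hTc1 : W \ T ∉ V₁) :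
    (∑ R ∈ W.powerset,
        (if ((R ∈ V₁ ∨ R ∈ V₂) ∧ W \ R ∉ V₁ ∧ W \ R ∉ V₂) ∧ (T ⊆ R ∧ R ⊆ S) then (1 : ZMod 2) else 0))
      + (∑ R ∈ W.powerset, (if T ⊆ R ∧ R ⊆ S ∧ W \ R ∈ V₂ then (1 : ZMod 2) else 0))
      = if T = S then 1 else 0 := by
  rw [← sum_powerset_ite_Icc (A := T) hSW, ← sum_add_distrib]
  refine sum_congr rfl fun R _ => ?_
  by_cases h : T ⊆ R ∧ R ⊆ S
  · have hR1 : R ∈ V₁ := up_mem h₁ h.1 hT1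
    have hRc1 : W \ R ∉ V₁ := up_not_mem h₁ (Finset.sdiff_subset_sdiff subset_rfl h.1) hTc1
    rw [if_pos h]
    by_cases h2 : W \ R ∈ V₂
    · rw [if_neg fun h' => h'.1.2.2 h2, if_pos ⟨h.1, h.2, h2⟩, zero_add]
    · rw [if_pos ⟨⟨Or.inl hR1, hRc1, h2⟩, h⟩, if_neg fun h' => h2 h'.2.2]
      decide
  · rw [if_neg fun h' => h h'.2, if_neg fun h' => h ⟨h'.1, h'.2.1⟩, if_neg h, add_zero]

/-! ## The kernel lemma -/

/-- **KERNEL LEMMA** (this work).  For up-sets `V₁, V₂` and a cube `W`: if `λ : POS → GF(2)` satisfies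
`Σ_{T ∈ POS, T ⊇ O} λ_T = 0` for every `O ∈ NEG`, then `λ = 0` on `POS`.  Equivalently the rows `1_{NEG ∩ ↓T}` (`T ∈ POS`) of the
containment matrix are linearly independent over `GF(2)`, i.e. the `POS × NEG` containment matrix has full row rank.
Proof: pair the hypothesis against the test functionals (I1) to get `Σ_T λ_T c(T,S) = 0` for every `S ∈ IN(V)`; on the kernel–bottom
sets `S` this isolates the cross part `Σ_{T ∈ X12} λ_T γ(T,S) = 0` (I2, I3), which extends to all `S ∈ IN(V₂)` and is inverted by the
parity lemma `Ξ² = I` (`gam_del_sum`), giving `λ = 0` on `X12`; then (I2) gives `λ = 0` on `POS ∩ IN(V)`. [this work] -/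
theorem pos_kernel_trivial {V₁ V₂ : Finset (Finset α)} (h₁ : IsUpperSet (V₁ : Set (Finset α))) (h₂ : IsUpperSet (V₂ : Set (Finset α)))
    (W : Finset α) (lam : Finset α → ZMod 2)
    (hlam : ∀ O ∈ neg V₁ V₂ W, (∑ T ∈ pos V₁ V₂ W, (if O ⊆ T then lam T else 0)) = 0) :
    ∀ T ∈ pos V₁ V₂ W, lam T = 0 := by
  -- facts about `POS`
  have posW : ∀ T ∈ pos V₁ V₂ W, T ⊆ W := fun T hT => (mem_pos_iff.1 hT).1
  have posU : ∀ T ∈ pos V₁ V₂ W, (T ∈ V₁ ∨ T ∈ V₂) ∧ W \ T ∉ V₁ := by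
    intro T hT
    rcases (mem_pos_iff.1 hT).2 with ⟨h1, -, h3⟩ | ⟨h1, -, h3, -⟩
    · exact ⟨Or.inl h1, h3⟩
    · exact ⟨Or.inr h1, h3⟩
  have posNK : ∀ T ∈ pos V₁ V₂ W, ¬ (T ∈ V₁ ∧ T ∈ V₂) := by
    intro T hT
    rcases (mem_pos_iff.1 hT).2 with ⟨-, h2, -⟩ | ⟨-, h2, -, -⟩
    · exact fun h => h2 h.2
    · exact fun h => h2 h.1
  have posX : ∀ T ∈ pos V₁ V₂ W, W \ T ∈ V₂ → T ∈ V₁ ∧ T ∉ V₂ ∧ W \ T ∉ V₁ := by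
    intro T hT hX
    rcases (mem_pos_iff.1 hT).2 with h | ⟨-, -, -, h4⟩
    · exact h
    · exact absurd hX h4
  have posOut : ∀ T ∈ pos V₁ V₂ W, W \ T ∈ V₂ → T ∈ outV V₂ W :=
    fun T hT hX => mem_outV_iff.2 ⟨posW T hT, (posX T hT hX).2.1, hX⟩
  -- (L2′): pairing the hypothesis with the test functionals
  have L2 : ∀ S, S ⊆ W → ((S ∈ V₁ ∨ S ∈ V₂) ∧ W \ S ∉ V₁ ∧ W \ S ∉ V₂) →
      (∑ T ∈ pos V₁ V₂ W, lam T * (∑ R ∈ W.powerset,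
          (if ((R ∈ V₁ ∨ R ∈ V₂) ∧ W \ R ∉ V₁ ∧ W \ R ∉ V₂) ∧ (T ⊆ R ∧ R ⊆ S) then (1 : ZMod 2) else 0))) = 0 := by
    intro S hSW hS
    calc (∑ T ∈ pos V₁ V₂ W, lam T * (∑ R ∈ W.powerset,
          (if ((R ∈ V₁ ∨ R ∈ V₂) ∧ W \ R ∉ V₁ ∧ W \ R ∉ V₂) ∧ (T ⊆ R ∧ R ⊆ S) then (1 : ZMod 2) else 0)))
        = ∑ T ∈ pos V₁ V₂ W, lam T * (∑ O ∈ neg V₁ V₂ W, (if O ⊆ T then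
            (∑ C ∈ neg V₁ V₂ W, (if O ⊆ C ∧ W \ S ⊆ C then (1 : ZMod 2) else 0)) else 0)) := by
          refine sum_congr rfl fun T hT => ?_
          rw [test_functional h₁ h₂ (posW T hT)]
      _ = ∑ O ∈ neg V₁ V₂ W, (∑ C ∈ neg V₁ V₂ W, (if O ⊆ C ∧ W \ S ⊆ C then (1 : ZMod 2) else 0)) *
            (∑ T ∈ pos V₁ V₂ W, (if O ⊆ T then lam T else 0)) := by
          rw [show (∑ T ∈ pos V₁ V₂ W, lam T * (∑ O ∈ neg V₁ V₂ W, (if O ⊆ T then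
              (∑ C ∈ neg V₁ V₂ W, (if O ⊆ C ∧ W \ S ⊆ C then (1 : ZMod 2) else 0)) else 0)))
            = ∑ T ∈ pos V₁ V₂ W, ∑ O ∈ neg V₁ V₂ W, lam T * (if O ⊆ T then
              (∑ C ∈ neg V₁ V₂ W, (if O ⊆ C ∧ W \ S ⊆ C then (1 : ZMod 2) else 0)) else 0) from
            sum_congr rfl fun T _ => Finset.mul_sum _ _ _, Finset.sum_comm]
          refine sum_congr rfl fun O _ => ?_
          rw [Finset.mul_sum]
          refine sum_congr rfl fun T _ => ?_
          by_cases hOT : O ⊆ T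
          · rw [if_pos hOT, if_pos hOT, mul_comm]
          · rw [if_neg hOT, if_neg hOT, mul_zero, mul_zero]
      _ = 0 := sum_eq_zero fun O hO => by rw [hlam O hO, mul_zero]
  -- Step A: on a kernel–bottom set `S`, only the cross part survives, with `c = γ`
  have stepA : ∀ S, S ⊆ W → S ∈ V₁ → S ∈ V₂ → W \ S ∉ V₁ → W \ S ∉ V₂ →
      (∑ T ∈ pos V₁ V₂ W, (if W \ T ∈ V₂ then lam T else 0) *
        (∑ R ∈ W.powerset, (if T ⊆ R ∧ R ⊆ S ∧ W \ R ∈ V₂ then (1 : ZMod 2) else 0))) = 0 := by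
    intro S hSW hS1 hS2 hSc1 hSc2
    refine Eq.trans (sum_congr rfl fun T hT => ?_) (L2 S hSW ⟨Or.inl hS1, hSc1, hSc2⟩)
    have hTS : T ≠ S := fun h => posNK T hT (h ▸ ⟨hS1, hS2⟩)
    by_cases hX : W \ T ∈ V₂
    · obtain ⟨hT1, -, hTc1⟩ := posX T hT hX
      rw [if_pos hX]
      have e := cfun_add_gam (V₂ := V₂) h₁ hSW hT1 hTc1
      rw [if_neg hTS] at e
      have e' := eq_neg_of_add_eq_zero_left e
      rw [ZMod.neg_eq_self_mod_two] at e'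
      rw [e']
    · rw [if_neg hX, zero_mul, cfun_diag h₁ h₂ hSW ⟨(posU T hT).1, (posU T hT).2, hX⟩, if_neg hTS, mul_zero]
  -- Step B: extend to every `S ∈ IN(V₂)`
  have stepB : ∀ S ∈ inV V₂ W,
      (∑ T ∈ pos V₁ V₂ W, (if W \ T ∈ V₂ then lam T else 0) *
        (∑ R ∈ W.powerset, (if T ⊆ R ∧ R ⊆ S ∧ W \ R ∈ V₂ then (1 : ZMod 2) else 0))) = 0 := by
    intro S hS
    obtain ⟨hSW, hS2, hSc2⟩ := mem_inV_iff.1 hS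
    by_cases hK : S ∈ V₁ ∧ W \ S ∉ V₁
    · exact stepA S hSW hK.1 hS2 hK.2 hSc2
    · refine sum_eq_zero fun T hT => ?_
      by_cases hX : W \ T ∈ V₂
      · obtain ⟨hT1, -, hTc1⟩ := posX T hT hX
        have hTS : ¬ T ⊆ S := fun h => hK ⟨up_mem h₁ h hT1, up_not_mem h₁ (Finset.sdiff_subset_sdiff subset_rfl h) hTc1⟩
        rw [sum_eq_zero fun R _ => if_neg fun h => hTS (h.1.trans h.2.1), mul_zero]
      · rw [if_neg hX, zero_mul]
  -- Step C: invert with the parity lemma: `λ = 0` on the cross part `X12`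
  have stepC : ∀ T'' ∈ pos V₁ V₂ W, W \ T'' ∈ V₂ → lam T'' = 0 := by
    intro T'' hT'' hX''
    calc lam T'' = ∑ T ∈ pos V₁ V₂ W, (if W \ T ∈ V₂ then lam T else 0) * (if T = T'' then 1 else 0) := by
          rw [show (∑ T ∈ pos V₁ V₂ W, (if W \ T ∈ V₂ then lam T else 0) * (if T = T'' then (1 : ZMod 2) else 0))
              = ∑ T ∈ pos V₁ V₂ W, (if T = T'' then (if W \ T ∈ V₂ then lam T else 0) else 0) from
            sum_congr rfl fun T _ => mul_boole _ _, Finset.sum_ite_eq', if_pos hT'', if_pos hX'']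
      _ = ∑ T ∈ pos V₁ V₂ W, (if W \ T ∈ V₂ then lam T else 0) * ∑ S ∈ inV V₂ W,
            ((∑ R ∈ W.powerset, (if T ⊆ R ∧ R ⊆ S ∧ W \ R ∈ V₂ then (1 : ZMod 2) else 0)) *
             (∑ C ∈ W.powerset, (if C ∈ V₂ ∧ T'' ⊆ C ∧ C ⊆ S then (1 : ZMod 2) else 0))) := by
          refine sum_congr rfl fun T hT => ?_
          by_cases hX : W \ T ∈ V₂
          · rw [gam_del_sum h₂ W (posOut T hT hX) (posOut T'' hT'' hX'')]
          · rw [if_neg hX, zero_mul, zero_mul]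
      _ = ∑ S ∈ inV V₂ W, (∑ C ∈ W.powerset, (if C ∈ V₂ ∧ T'' ⊆ C ∧ C ⊆ S then (1 : ZMod 2) else 0)) *
            (∑ T ∈ pos V₁ V₂ W, (if W \ T ∈ V₂ then lam T else 0) *
              (∑ R ∈ W.powerset, (if T ⊆ R ∧ R ⊆ S ∧ W \ R ∈ V₂ then (1 : ZMod 2) else 0))) := by
          rw [show (∑ T ∈ pos V₁ V₂ W, (if W \ T ∈ V₂ then lam T else 0) * ∑ S ∈ inV V₂ W,
              ((∑ R ∈ W.powerset, (if T ⊆ R ∧ R ⊆ S ∧ W \ R ∈ V₂ then (1 : ZMod 2) else 0)) *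
               (∑ C ∈ W.powerset, (if C ∈ V₂ ∧ T'' ⊆ C ∧ C ⊆ S then (1 : ZMod 2) else 0))))
            = ∑ T ∈ pos V₁ V₂ W, ∑ S ∈ inV V₂ W, (if W \ T ∈ V₂ then lam T else 0) *
              ((∑ R ∈ W.powerset, (if T ⊆ R ∧ R ⊆ S ∧ W \ R ∈ V₂ then (1 : ZMod 2) else 0)) *
               (∑ C ∈ W.powerset, (if C ∈ V₂ ∧ T'' ⊆ C ∧ C ⊆ S then (1 : ZMod 2) else 0))) from
            sum_congr rfl fun T _ => Finset.mul_sum _ _ _, Finset.sum_comm]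
          refine sum_congr rfl fun S _ => ?_
          rw [Finset.mul_sum]
          refine sum_congr rfl fun T _ => ?_
          ring
      _ = 0 := sum_eq_zero fun S hS => by rw [stepB S hS, mul_zero]
  -- Step D: `λ = 0` on `POS ∩ IN(V)` by the diagonal values (I2)
  have stepD : ∀ S ∈ pos V₁ V₂ W, W \ S ∉ V₂ → lam S = 0 := by
    intro S hS hXS
    have hSW := posW S hS
    have hSU : (S ∈ V₁ ∨ S ∈ V₂) ∧ W \ S ∉ V₁ ∧ W \ S ∉ V₂ := ⟨(posU S hS).1, (posU S hS).2, hXS⟩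
    have e := L2 S hSW hSU
    rw [show (∑ T ∈ pos V₁ V₂ W, lam T * (∑ R ∈ W.powerset,
          (if ((R ∈ V₁ ∨ R ∈ V₂) ∧ W \ R ∉ V₁ ∧ W \ R ∉ V₂) ∧ (T ⊆ R ∧ R ⊆ S) then (1 : ZMod 2) else 0)))
        = ∑ T ∈ pos V₁ V₂ W, (if T = S then lam T else 0) by
      refine sum_congr rfl fun T hT => ?_
      by_cases hX : W \ T ∈ V₂
      · have hTS : T ≠ S := fun h => hXS (h ▸ hX)
        rw [stepC T hT hX, zero_mul, if_neg hTS]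
      · rw [cfun_diag h₁ h₂ hSW ⟨(posU T hT).1, (posU T hT).2, hX⟩, mul_boole]] at e
    rw [Finset.sum_ite_eq'] at e
    rwa [if_pos hS] at e
  intro T hT
  by_cases hX : W \ T ∈ V₂
  · exact stepC T hT hX
  · exact stepD T hT hX

end HallGladkov

end Summit.CriticalPhenomena.PercolationContinuityZ3.Theorems.SunflowerPartition
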